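/-
Copyright (c) 2026 the pub-hodgecm-mathlib formalisation cell (harness21).  Prover seat hodgecm-mathlib-K2-defs1 (g6), Track B, h413 = `stmt-HodgeConjecture-24833`, route `HCCMUnconditional`,
answer to K2E4-p10 (g7) 2026-09-04T13:34:40Z «(ARCH-CONST)» (dealer K2E1-plan (g7) (248)(b)∕(254) `hdec′` road): sections with `χ_∞ = 1` depend only on the finite-adelic component.
-/
import Summits.HodgeConjecture.HodgeConjecture.Theorems.K2E1ChiHeckeArchScalarU2     -- ★ 12d-C (this seat): `exists_mem_comap_borel_mul_mem_comap_K_arch` (arch Iwasawa, comap spelling); brings ★ rows 9∕3, `UnitaryGroupAdelicProduct`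
import HarnessLib

/-!
# `K2E1ChiSectionArchConstantLineU2` — (ARCH-CONST): A SECTION `φ ∈ V(χ, K′, ω)` WITH `χ_∞ = 1`, `ι(K_∞) ⊆ K′` AND `ω = 1` ON `ι(K_∞)` DEPENDS ONLY ON THE FINITE-ADELIC COMPONENT —
# `φ(g) = φ(ι_f(g_f))`; hence `φ` is CONSTANT along every curve moving only the archimedean component (K2E4-p10's `hdec′` input «φ constant along the archimedean line»)

Cell `pub/hodgecm-mathlib`, crux H413 = `stmt-HodgeConjecture-24833`.  THEOREMS ONLY (no `def`, no `instance`, no notation, no named-fact hypothesis, no `sorry`); lane `--supports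
stmt-HodgeConjecture-24833 --as helper` (count-neutral).  Closes no socket.  §1–§2 generic `(F, E, c)` with `c ≠ 1` fixing the infinite places, every rank `N`; §3 the CM ∕ maximal-level print.

THE MATHEMATICS ([BorelJacquet1979, §4.1]; [Bump1997, §3.3]).  `g = ι(g_∞)·ι_f(g_f)` with commuting factors (★ `UnitaryGroupAdelicProduct`); arch Iwasawa `g_∞ = β κ` with `ι(β) ∈ B(𝔸)`, `ι(κ) ∈ K` (★ 12d-C
`exists_mem_comap_borel_mul_mem_comap_K_arch`); then `φ(g) = φ(ι(β)·ι_f(g_f)·ι(κ)) = ω(ι κ)·χ(β₀₀)·φ(ι_f(g_f)) = φ(ι_f(g_f))` by right-`K′`-equivariance (`ι(κ) ∈ K′`, `ω(ι κ) = 1`) and the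
`χ`-section property with `χ(β₀₀) = 1` (`χ_∞ = 1`).  Consequences: `φ(ι(a)·g) = φ(g) = φ(g·ι(a))`, `φ(g₁) = φ(g₂)` whenever `(g₁)_f = (g₂)_f`, and `φ(ι a) = φ(1)` (the `hVinf` binder of ★ p860121).
* §1 **`apply_eq_apply_finPart`**.  * §2 `apply_archToAdelic_mul`, `apply_mul_archToAdelic`, `apply_eq_of_finPart_eq`, `apply_archToAdelic_eq_apply_one`.
* §3 (maximal level, `ω = 1`) **`apply_eq_apply_finPart_maximalLevel`**, `hVinf_maximalLevel` (★ p860121's binder), and the CM packaging `…_cm`.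
HONEST LABEL: HC_CM is proved only modulo the 7 printed citations (2 remaining named inputs: hLiu418 = `stmt-HodgeConjecture-24832`, h413 = `stmt-HodgeConjecture-24833`) until rung 0
closes; count-neutral helper, closes no socket.  The hypothesis `hχ` (χ trivial on the archimedean Borel ideles, i.e. `χ_∞ = 1`) stays a binder (M1 datum).

## References
* [BorelJacquet1979] A. Borel, H. Jacquet, *Automorphic forms and automorphic representations*, Proc. Symp. Pure Math. 33.1 (1979), §4.1.
* [Bump1997] D. Bump, *Automorphic Forms and Representations* (1997), §3.3.
-/

set_option autoImplicit false
set_option linter.dupNamespace false  -- the mandated namespace repeats the summit's segment (`HodgeConjecture.HodgeConjecture`)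

noncomputable section

open NumberField NumberField.mixedEmbedding NumberField.InfinitePlace IsDedekindDomain
open scoped NNReal MatrixGroups
open Literature.NumberTheory Literature.NumberTheory.Automorphic Literature.NumberTheory.Automorphic.UnitaryGroup AdelicGroupData
open Literature.NumberTheory.GaloisRepresentations (HeckeCharacter)
open Summit.HodgeConjecture.HodgeConjecture.Cruxes.H413.K2E1BorelEisensteinU
open Summit.HodgeConjecture.HodgeConjecture.Cruxes.H413.K2E1CharacterEisensteinU2Defs
open Summit.HodgeConjecture.HodgeConjecture.Cruxes.H413.K2E1ChiSectionSpaceU2Defs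
open Summit.HodgeConjecture.HodgeConjecture.Cruxes.H413.K2E1ChiHeckeArchScalarU2 (exists_mem_comap_borel_mul_mem_comap_K_arch)

namespace Summit.HodgeConjecture.HodgeConjecture.Cruxes.H413.K2E1ChiSectionArchConstantLineU2

/-! ## §1 `φ(g) = φ(ι_f(g_f))` -/

section General

variable {F E : Type} [Field F] [NumberField F] [Field E] [NumberField E] [Algebra F E] {c : E ≃ₐ[F] E} {N : ℕ} [NeZero N]
variable {χ : HeckeCharacter E} {K' : Subgroup (quasiSplit F E c N).Adelic} {ω : ↥K' → ℂ}

/-- **(ARCH-CONST) `φ(g) = φ(ι_f(g_f))`**: for `c ≠ 1` fixing the infinite places, `φ ∈ V(χ, K′, ω)` with `ι(K_∞) ⊆ K′`, `ω = 1` on `ι(K_∞)`, and `χ` trivial on the archimedean Borel ideles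
(`χ(β₀₀) = 1` for `ι(β) ∈ B(𝔸)` — «`χ_∞ = 1`»), the section depends only on the finite-adelic component of its argument. [cite: BorelJacquet1979, §4.1] [cite: Bump1997, §3.3] -/
theorem apply_eq_apply_finPart (hc : c ≠ 1) (hfix : ∀ w : InfinitePlace E, c • w = w)
    (hKinf : ∀ k : arch F E c N ((StdForm.antidiagonal N).over E),
      adelicVal F E c N ((StdForm.antidiagonal N).over E) (archToAdelic F E c N _ k) ∈ standardMaximalCompactGL N E → archToAdelic F E c N _ k ∈ K')
    (hω : ∀ (k : arch F E c N ((StdForm.antidiagonal N).over E)) (hk : archToAdelic F E c N _ k ∈ K'),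
      adelicVal F E c N ((StdForm.antidiagonal N).over E) (archToAdelic F E c N _ k) ∈ standardMaximalCompactGL N E → ω ⟨_, hk⟩ = 1)
    (hχ : ∀ (a : arch F E c N ((StdForm.antidiagonal N).over E)) (hb : archToAdelic F E c N ((StdForm.antidiagonal N).over E) a ∈ borelAdelic F E c N),
      ((χ (firstEntryUnit hb) : ℂˣ) : ℂ) = 1)
    {φ : (quasiSplit F E c N).Adelic → ℂ} (hφ : φ ∈ chiSectionSpace χ K' ω) (g : (quasiSplit F E c N).Adelic) :
    φ g = φ (finAdelicToAdelic F E c N ((StdForm.antidiagonal N).over E) (finPart F E c N _ g)) := by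
  obtain ⟨β, hβ, κ, hκ, hak⟩ := exists_mem_comap_borel_mul_mem_comap_K_arch hc hfix (archPart F E c N ((StdForm.antidiagonal N).over E) g)
  have hβ' : archToAdelic F E c N ((StdForm.antidiagonal N).over E) β ∈ borelAdelic F E c N := Subgroup.mem_comap.1 hβ
  have hκ' : adelicVal F E c N ((StdForm.antidiagonal N).over E) (archToAdelic F E c N _ κ) ∈ standardMaximalCompactGL N E := Subgroup.mem_comap.1 (Subgroup.mem_comap.1 hκ)
  have hκK : archToAdelic F E c N _ κ ∈ K' := hKinf κ hκ'
  -- `g = ι(β) · (ι_f(g_f) · ι(κ))`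
  have e : g = archToAdelic F E c N _ β * finAdelicToAdelic F E c N _ (finPart F E c N _ g) * archToAdelic F E c N _ κ := by
    conv_lhs => rw [← archToAdelic_mul_finAdelicToAdelic F E c N ((StdForm.antidiagonal N).over E) g, hak, map_mul, mul_assoc,
      (commute_archToAdelic_finAdelicToAdelic F E c N _ κ (finPart F E c N _ g)).eq, ← mul_assoc]
  have step : φ g = φ (archToAdelic F E c N _ β * finAdelicToAdelic F E c N _ (finPart F E c N _ g) * archToAdelic F E c N _ κ) := congrArg φ e
  rw [step, show φ (archToAdelic F E c N _ β * finAdelicToAdelic F E c N _ (finPart F E c N _ g) * archToAdelic F E c N _ κ) =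
      φ (archToAdelic F E c N _ β * finAdelicToAdelic F E c N _ (finPart F E c N _ g) * ((⟨archToAdelic F E c N _ κ, hκK⟩ : ↥K') : (quasiSplit F E c N).Adelic)) from rfl,
    ((mem_chiSectionSpace_iff _).1 hφ).2 _ ⟨_, hκK⟩, hω κ hκK hκ', one_mul, ((mem_chiSectionSpace_iff _).1 hφ).1 _ hβ' _, hχ β hβ', one_mul]

/-! ## §2 Consequences: invariance under archimedean multiplication on either side -/

/-- `φ(ι(a)·g) = φ(g)` (the finite component of `ι(a)·g` is `g_f`). [cite: BorelJacquet1979, §4.1] -/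
theorem apply_archToAdelic_mul (hc : c ≠ 1) (hfix : ∀ w : InfinitePlace E, c • w = w)
    (hKinf : ∀ k : arch F E c N ((StdForm.antidiagonal N).over E),
      adelicVal F E c N ((StdForm.antidiagonal N).over E) (archToAdelic F E c N _ k) ∈ standardMaximalCompactGL N E → archToAdelic F E c N _ k ∈ K')
    (hω : ∀ (k : arch F E c N ((StdForm.antidiagonal N).over E)) (hk : archToAdelic F E c N _ k ∈ K'),
      adelicVal F E c N ((StdForm.antidiagonal N).over E) (archToAdelic F E c N _ k) ∈ standardMaximalCompactGL N E → ω ⟨_, hk⟩ = 1)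
    (hχ : ∀ (a : arch F E c N ((StdForm.antidiagonal N).over E)) (hb : archToAdelic F E c N ((StdForm.antidiagonal N).over E) a ∈ borelAdelic F E c N),
      ((χ (firstEntryUnit hb) : ℂˣ) : ℂ) = 1)
    {φ : (quasiSplit F E c N).Adelic → ℂ} (hφ : φ ∈ chiSectionSpace χ K' ω) (a : arch F E c N ((StdForm.antidiagonal N).over E)) (g : (quasiSplit F E c N).Adelic) :
    φ (archToAdelic F E c N _ a * g) = φ g := by
  rw [apply_eq_apply_finPart hc hfix hKinf hω hχ hφ (archToAdelic F E c N _ a * g), apply_eq_apply_finPart hc hfix hKinf hω hχ hφ g, map_mul, finPart_archToAdelic, one_mul]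

/-- `φ(g·ι(a)) = φ(g)`. [cite: BorelJacquet1979, §4.1] -/
theorem apply_mul_archToAdelic (hc : c ≠ 1) (hfix : ∀ w : InfinitePlace E, c • w = w)
    (hKinf : ∀ k : arch F E c N ((StdForm.antidiagonal N).over E),
      adelicVal F E c N ((StdForm.antidiagonal N).over E) (archToAdelic F E c N _ k) ∈ standardMaximalCompactGL N E → archToAdelic F E c N _ k ∈ K')
    (hω : ∀ (k : arch F E c N ((StdForm.antidiagonal N).over E)) (hk : archToAdelic F E c N _ k ∈ K'),
      adelicVal F E c N ((StdForm.antidiagonal N).over E) (archToAdelic F E c N _ k) ∈ standardMaximalCompactGL N E → ω ⟨_, hk⟩ = 1)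
    (hχ : ∀ (a : arch F E c N ((StdForm.antidiagonal N).over E)) (hb : archToAdelic F E c N ((StdForm.antidiagonal N).over E) a ∈ borelAdelic F E c N),
      ((χ (firstEntryUnit hb) : ℂˣ) : ℂ) = 1)
    {φ : (quasiSplit F E c N).Adelic → ℂ} (hφ : φ ∈ chiSectionSpace χ K' ω) (g : (quasiSplit F E c N).Adelic) (a : arch F E c N ((StdForm.antidiagonal N).over E)) :
    φ (g * archToAdelic F E c N _ a) = φ g := by
  rw [apply_eq_apply_finPart hc hfix hKinf hω hχ hφ (g * archToAdelic F E c N _ a), apply_eq_apply_finPart hc hfix hKinf hω hχ hφ g, map_mul, finPart_archToAdelic, mul_one]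

/-- **CONSTANCY ALONG ARCHIMEDEAN CURVES**: `(g₁)_f = (g₂)_f ⟹ φ(g₁) = φ(g₂)` — so `t ↦ φ(γ(t))` is constant along any `γ` whose finite component is constant (e.g. `t ↦ ι(w₀)·n(θ(a(t), b))·k`).
[cite: BorelJacquet1979, §4.1] -/
theorem apply_eq_of_finPart_eq (hc : c ≠ 1) (hfix : ∀ w : InfinitePlace E, c • w = w)
    (hKinf : ∀ k : arch F E c N ((StdForm.antidiagonal N).over E),
      adelicVal F E c N ((StdForm.antidiagonal N).over E) (archToAdelic F E c N _ k) ∈ standardMaximalCompactGL N E → archToAdelic F E c N _ k ∈ K')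
    (hω : ∀ (k : arch F E c N ((StdForm.antidiagonal N).over E)) (hk : archToAdelic F E c N _ k ∈ K'),
      adelicVal F E c N ((StdForm.antidiagonal N).over E) (archToAdelic F E c N _ k) ∈ standardMaximalCompactGL N E → ω ⟨_, hk⟩ = 1)
    (hχ : ∀ (a : arch F E c N ((StdForm.antidiagonal N).over E)) (hb : archToAdelic F E c N ((StdForm.antidiagonal N).over E) a ∈ borelAdelic F E c N),
      ((χ (firstEntryUnit hb) : ℂˣ) : ℂ) = 1)
    {φ : (quasiSplit F E c N).Adelic → ℂ} (hφ : φ ∈ chiSectionSpace χ K' ω) {g₁ g₂ : (quasiSplit F E c N).Adelic}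
    (h : finPart F E c N ((StdForm.antidiagonal N).over E) g₁ = finPart F E c N _ g₂) : φ g₁ = φ g₂ := by
  rw [apply_eq_apply_finPart hc hfix hKinf hω hχ hφ g₁, apply_eq_apply_finPart hc hfix hKinf hω hχ hφ g₂, h]

/-- `φ(ι a) = φ(1)` — the `hVinf` binder of ★ p860121 `K2E1ChiConvDataLettersMaximalLevelU2`, discharged from `χ_∞ = 1`. [cite: BorelJacquet1979, §4.1] -/
theorem apply_archToAdelic_eq_apply_one (hc : c ≠ 1) (hfix : ∀ w : InfinitePlace E, c • w = w)
    (hKinf : ∀ k : arch F E c N ((StdForm.antidiagonal N).over E),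
      adelicVal F E c N ((StdForm.antidiagonal N).over E) (archToAdelic F E c N _ k) ∈ standardMaximalCompactGL N E → archToAdelic F E c N _ k ∈ K')
    (hω : ∀ (k : arch F E c N ((StdForm.antidiagonal N).over E)) (hk : archToAdelic F E c N _ k ∈ K'),
      adelicVal F E c N ((StdForm.antidiagonal N).over E) (archToAdelic F E c N _ k) ∈ standardMaximalCompactGL N E → ω ⟨_, hk⟩ = 1)
    (hχ : ∀ (a : arch F E c N ((StdForm.antidiagonal N).over E)) (hb : archToAdelic F E c N ((StdForm.antidiagonal N).over E) a ∈ borelAdelic F E c N),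
      ((χ (firstEntryUnit hb) : ℂˣ) : ℂ) = 1)
    {φ : (quasiSplit F E c N).Adelic → ℂ} (hφ : φ ∈ chiSectionSpace χ K' ω) (a : arch F E c N ((StdForm.antidiagonal N).over E)) :
    φ (archToAdelic F E c N _ a) = φ 1 := by
  rw [← mul_one (archToAdelic F E c N _ a), apply_archToAdelic_mul hc hfix hKinf hω hχ hφ a 1]

end General

/-! ## §3 Maximal level (`K′ = K`, `ω = 1`) and the CM packaging -/

section Maximal

variable {F E : Type} [Field F] [NumberField F] [Field E] [NumberField E] [Algebra F E] {c : E ≃ₐ[F] E} {N : ℕ} [NeZero N] {χ : HeckeCharacter E}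

/-- **MAXIMAL LEVEL**: for `φ ∈ V(χ, K, 1)` and `χ_∞ = 1`, `φ(g) = φ(ι_f(g_f))` (the `K`-binders of §1 are automatic). [cite: BorelJacquet1979, §4.1] -/
theorem apply_eq_apply_finPart_maximalLevel (hc : c ≠ 1) (hfix : ∀ w : InfinitePlace E, c • w = w)
    (hχ : ∀ (a : arch F E c N ((StdForm.antidiagonal N).over E)) (hb : archToAdelic F E c N ((StdForm.antidiagonal N).over E) a ∈ borelAdelic F E c N),
      ((χ (firstEntryUnit hb) : ℂˣ) : ℂ) = 1)
    {φ : (quasiSplit F E c N).Adelic → ℂ}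
    (hφ : φ ∈ chiSectionSpace χ (((standardMaximalCompactGL N E).comap (adelicVal F E c N ((StdForm.antidiagonal N).over E)) : Subgroup (quasiSplit F E c N).Adelic)) (fun _ => 1))
    (g : (quasiSplit F E c N).Adelic) :
    φ g = φ (finAdelicToAdelic F E c N ((StdForm.antidiagonal N).over E) (finPart F E c N _ g)) :=
  apply_eq_apply_finPart hc hfix (fun _ hk => Subgroup.mem_comap.2 hk) (fun _ _ _ => rfl) hχ hφ g

/-- **THE `hVinf` BINDER OF ★ p860121 AT MAXIMAL LEVEL**: `∀ φ ∈ V(χ, K, 1), ∀ a, φ(ι a) = φ(1)`, from `χ_∞ = 1`. [cite: BorelJacquet1979, §4.1] -/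
theorem hVinf_maximalLevel (hc : c ≠ 1) (hfix : ∀ w : InfinitePlace E, c • w = w)
    (hχ : ∀ (a : arch F E c N ((StdForm.antidiagonal N).over E)) (hb : archToAdelic F E c N ((StdForm.antidiagonal N).over E) a ∈ borelAdelic F E c N),
      ((χ (firstEntryUnit hb) : ℂˣ) : ℂ) = 1) :
    ∀ φ ∈ chiSectionSpace χ (((standardMaximalCompactGL N E).comap (adelicVal F E c N ((StdForm.antidiagonal N).over E)) : Subgroup (quasiSplit F E c N).Adelic)) (fun _ => 1),
      ∀ a : arch F E c N ((StdForm.antidiagonal N).over E), φ (archToAdelic F E c N _ a) = φ 1 :=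
  fun _ hφ a => apply_archToAdelic_eq_apply_one hc hfix (fun _ hk => Subgroup.mem_comap.2 hk) (fun _ _ _ => rfl) hχ hφ a

end Maximal

section CM

variable (L : Type) [Field L] [NumberField L] [IsCMField L] {N : ℕ} [NeZero N] {χ : HeckeCharacter L}
variable {K' : Subgroup (quasiSplit (↥(maximalRealSubfield L)) L (IsCMField.complexConj L) N).Adelic} {ω : ↥K' → ℂ}

/-- **CM PACKAGING** (`F = L⁺`, `E = L`, `c` = complex conjugation, hypothesis-free Iwasawa): `φ(g) = φ(ι_f(g_f))` for `φ ∈ V(χ, K′, ω)` under `ι(K_∞) ⊆ K′`, `ω = 1` on `ι(K_∞)`, `χ_∞ = 1`.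
[cite: BorelJacquet1979, §4.1] -/
theorem apply_eq_apply_finPart_cm
    (hKinf : ∀ k : arch (↥(maximalRealSubfield L)) L (IsCMField.complexConj L) N ((StdForm.antidiagonal N).over L),
      adelicVal (↥(maximalRealSubfield L)) L (IsCMField.complexConj L) N ((StdForm.antidiagonal N).over L) (archToAdelic (↥(maximalRealSubfield L)) L (IsCMField.complexConj L) N _ k) ∈
        standardMaximalCompactGL N L → archToAdelic (↥(maximalRealSubfield L)) L (IsCMField.complexConj L) N _ k ∈ K')
    (hω : ∀ (k : arch (↥(maximalRealSubfield L)) L (IsCMField.complexConj L) N ((StdForm.antidiagonal N).over L)) (hk : archToAdelic (↥(maximalRealSubfield L)) L (IsCMField.complexConj L) N _ k ∈ K'),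
      adelicVal (↥(maximalRealSubfield L)) L (IsCMField.complexConj L) N ((StdForm.antidiagonal N).over L) (archToAdelic (↥(maximalRealSubfield L)) L (IsCMField.complexConj L) N _ k) ∈
        standardMaximalCompactGL N L → ω ⟨_, hk⟩ = 1)
    (hχ : ∀ (a : arch (↥(maximalRealSubfield L)) L (IsCMField.complexConj L) N ((StdForm.antidiagonal N).over L))
      (hb : archToAdelic (↥(maximalRealSubfield L)) L (IsCMField.complexConj L) N ((StdForm.antidiagonal N).over L) a ∈ borelAdelic (↥(maximalRealSubfield L)) L (IsCMField.complexConj L) N),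
      ((χ (firstEntryUnit hb) : ℂˣ) : ℂ) = 1)
    {φ : (quasiSplit (↥(maximalRealSubfield L)) L (IsCMField.complexConj L) N).Adelic → ℂ} (hφ : φ ∈ chiSectionSpace χ K' ω)
    (g : (quasiSplit (↥(maximalRealSubfield L)) L (IsCMField.complexConj L) N).Adelic) :
    φ g = φ (finAdelicToAdelic (↥(maximalRealSubfield L)) L (IsCMField.complexConj L) N ((StdForm.antidiagonal N).over L)
      (finPart (↥(maximalRealSubfield L)) L (IsCMField.complexConj L) N _ g)) :=
  apply_eq_apply_finPart (IsCMField.complexConj_ne_one L) (complexConj_smul_infinitePlace L) hKinf hω hχ hφ g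

end CM

end Summit.HodgeConjecture.HodgeConjecture.Cruxes.H413.K2E1ChiSectionArchConstantLineU2
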